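import Summits.QuantumFields.YangMills.Theorems.UnitScaleTiltProp7LocalModelJunction
import Summits.QuantumFields.YangMills.Theorems.UnitScaleTiltProp7LocalModelAverage
import HarnessLib

/-!
# Route `UnitScaleTilt`, crux K1 «MinimiserStabilityRegPr» (stmt-QuantumFields-19200), route-R E′ path (α′), S3 K-form engine, row (H) junction (J-δV) — FILE 9t (T³ letters):
# THE RECENTRING GROUP OF THE OFFSET-COMB FAMILY AT `Z := Ψ̄_(B(z))`, SUMMED — the inhabitant-side junction of ★p1 g16's `hGJ_pt` (✓p679008): with the support's own reference
# block `B(z) = iterBlockOf (z − s𝟙)` as recentring, `Σ_y Σ_(z∈N(y)) Σ_μ ‖Ψ̄_y(z) − Ψ̄_(B(z))(z)‖² ≤ d·Σ_y Σ_(z∈N(y)) ℓ′⁻¹Σ_(h<ℓ′) 2·(‖R(S_(y,z))φ₀(c_y) − φ₀(c_(B(z)))‖² +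
# ‖[JLOOP^h_(y,z), φ₀(c_y)]‖²)` for ANY bi-contractive transports `S_(y,z)` (the consumer's straight coarse transport `c_y → c_(B(z))`, booked against `δ^V` by the telescope
# ✓ `norm_R_mul_sub_le` and the `W̄ ↔ S` bridge ✓ `norm_R_sub_le_of_defect`) and the explicit junction-loop units `JLOOP = S⁻¹·𝒲(c_B; path_B)·𝒲(c_y; path_y)⁻¹` ((Kg′-J) family).

Cell `ym3-torus`, D-0154 (3c) twin-width seat `ym-routeR-w1` (gen 6); ★p1 g16 NAMER WORD 6 (i) (junction shape YES), WORD 11 (display: junction families feed hGJ_pt).  THEOREMS ONLY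
(0 `def`, 0 `sorry`); `--supports stmt-QuantumFields-19200`, count-neutral.  YM₃ on T³ is a ladder rung (R3), not the Clay problem; nothing here claims a stub, the crux, d = 4 or the gap.

WHAT (ns `…Theorems.Prop7JunctionGroupOfOffsetFamily`).
* §1 `norm_sq_avg_sub_avg_le` (convexity of the averaged difference), ★★ `norm_sq_avg_axialModel_offset_sub_le` (any torus: two bases, same `z`, averaged over the offsets:
  `‖Ψ̄_(c₀)(z) − Ψ̄_(c₀′)(z)‖² ≤ |H|⁻¹Σ_η 2(‖R(S)m − m′‖² + ‖[JLOOP_η, m]‖²)`, ✓ `norm_axialModel_offset_sub_le`).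
* §2 ★★★ `junctionGroup_offsetFamily_le` — the T³ sum over `y, z ∈ N(y), μ` (the `μ`-sum is the factor `d`).
HONEST SCOPE.  Exact inequalities; `S` free; no booking.

References: T. Bałaban, CMP 99 (1985) 389–434 [Balaban1985BackgroundPropagators] ((3.1) p.390, (3.12) p.392); CMP 102 (1985) 255–275 [Balaban1985UV3] ((27) p.263).
-/

set_option autoImplicit false

noncomputable section

open scoped BigOperators Matrix.Norms.L2Operator Matrix

namespace Summit.QuantumFields.YangMills.Theorems.Prop7JunctionGroupOfOffsetFamily

open Literature.MathematicalPhysics.QuantumFieldTheory.Balaban1983to89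
open Literature.MathematicalPhysics.QuantumFieldTheory.Balaban1983to89.T3ContinuumYM3Torus
open B7Prop1Explicit (Letter e seg treeWord hol)
open B9Eq39Adjoint (R covD covDstar divB)
open B9TorusCalculus (torusT)
open B10Eq27TorusAxialLog (unitsField toUField holT axialT rel transl)
open B5Eq118OneStroke (iterBlockOf)
open B15DeterminingSets (embIter)
open Summit.QuantumFields.YangMills.Theorems.Prop7CovHodgeSplit (unitsField_toUField_mem_unitary)
open Summit.QuantumFields.YangMills.Theorems.Prop7LemmaHCurvedOfRows (bicontr_of_mem_unitary)
open Summit.QuantumFields.YangMills.Theorems.Prop7LocalModelAverage (norm_sq_avg_le)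
open Summit.QuantumFields.YangMills.Theorems.Prop7LocalModelJunction (norm_axialModel_offset_sub_le)

/-! ## §1 Two averaged offset-comb models at the same site -/

section Torus

variable {𝔸 : Type*} [NormedRing 𝔸] [NormedAlgebra ℝ 𝔸] [NormOneClass 𝔸] {P : Params} {j : ℕ} (V : GaugeField P j 𝔸ˣ)
  (hV : ∀ b : PBond P j, ‖(V b : 𝔸)‖ ≤ 1 ∧ ‖(((V b)⁻¹ : 𝔸ˣ) : 𝔸)‖ ≤ 1)

omit [NormOneClass 𝔸] in
/-- convexity of the averaged difference: `‖|H|⁻¹Σa − |H|⁻¹Σb‖² ≤ |H|⁻¹Σ‖a_η − b_η‖²`. [folklore] -/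
theorem norm_sq_avg_sub_avg_le {H : Type*} [Fintype H] [Nonempty H] (a b : H → 𝔸) :
    ‖(Fintype.card H : ℝ)⁻¹ • ∑ η, a η - (Fintype.card H : ℝ)⁻¹ • ∑ η, b η‖ ^ 2 ≤ (Fintype.card H : ℝ)⁻¹ * ∑ η, ‖a η - b η‖ ^ 2 := by
  rw [← smul_sub, ← Finset.sum_sub_distrib]
  exact norm_sq_avg_le _

include hV in
/-- ★★ **TWO AVERAGED OFFSET-COMB MODELS AT THE SAME SITE**: bases `c₀, c₀′`, offsets `g η`, data `m, m′`, ANY bi-contractive `S`: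
`‖Ψ̄_(c₀)(z) − Ψ̄_(c₀′)(z)‖² ≤ |H|⁻¹Σ_η 2·(‖R(S)m − m′‖² + ‖[S⁻¹·V(c₀′;path′_η)·V(c₀;path_η)⁻¹, m]‖²)` (convexity ∘ ✓ `norm_axialModel_offset_sub_le` ∘ `(a+b)² ≤ 2a²+2b²`).
[cite: Balaban1985BackgroundPropagators, (3.1) p.390, (3.12) p.392] [cite: Balaban1985UV3, (27) p.263] -/
theorem norm_sq_avg_axialModel_offset_sub_le {H : Type*} [Fintype H] [Nonempty H] (g : H → ℤ) (c₀ c₀' : Site P j) (ι : Fin P.d) (z : Site P j) (m m' : 𝔸)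
    (S : 𝔸ˣ) (hS : ‖(S : 𝔸)‖ ≤ 1 ∧ ‖((S⁻¹ : 𝔸ˣ) : 𝔸)‖ ≤ 1) :
    ‖(Fintype.card H : ℝ)⁻¹ • ∑ η, R (axialT V (transl c₀ (g η • e ι)) z)⁻¹ (R (holT V c₀ (seg ι (g η)))⁻¹ m)
        - (Fintype.card H : ℝ)⁻¹ • ∑ η, R (axialT V (transl c₀' (g η • e ι)) z)⁻¹ (R (holT V c₀' (seg ι (g η)))⁻¹ m')‖ ^ 2
      ≤ (Fintype.card H : ℝ)⁻¹ * ∑ η, 2 * (‖R S m - m'‖ ^ 2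
          + ‖((S⁻¹ * holT V c₀' (seg ι (g η) ++ treeWord (rel (transl c₀' (g η • e ι)) z)) * (holT V c₀ (seg ι (g η) ++ treeWord (rel (transl c₀ (g η • e ι)) z)))⁻¹ : 𝔸ˣ) : 𝔸) * m
              - m * ((S⁻¹ * holT V c₀' (seg ι (g η) ++ treeWord (rel (transl c₀' (g η • e ι)) z)) * (holT V c₀ (seg ι (g η) ++ treeWord (rel (transl c₀ (g η • e ι)) z)))⁻¹ : 𝔸ˣ) : 𝔸)‖ ^ 2) := by
  refine (norm_sq_avg_sub_avg_le _ _).trans (mul_le_mul_of_nonneg_left (Finset.sum_le_sum fun η _ => ?_) (by positivity))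
  have h := norm_axialModel_offset_sub_le V hV c₀ c₀' ι (g η) z m m' S hS
  have h2 : ∀ a b x : ℝ, 0 ≤ x → x ≤ a + b → x ^ 2 ≤ 2 * (a ^ 2 + b ^ 2) := fun a b x hx hab => by nlinarith [sq_nonneg (a - b)]
  exact h2 _ _ _ (norm_nonneg _) h

end Torus

/-! ## §2 The junction group on T³ -/

section T3

/-- ★★★ **THE JUNCTION GROUP OF THE OFFSET-COMB FAMILY** (recentring `Z_μ(z) := Ψ̄_(B(z))(z)`, `B(z)` the support's reference block): summed over `y`, `z ∈ N(y)` and `μ` (factor `d`),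
the pointwise recentring group of ✓ `lemmaH_curved_offset_avg_count_transported_pt` is at most `d·Σ_yΣ_(z:N)ℓ′⁻¹Σ_h 2(‖R(S_(y,z))φ₀(c_y) − φ₀(c_(B(z)))‖² + ‖[JLOOP, φ₀(c_y)]‖²)` for ANY
bi-contractive transports `S_(y,z)`. [cite: Balaban1985BackgroundPropagators, (3.1) p.390, (3.12) p.392] [cite: Balaban1985UV3, (27) p.263] -/
theorem junctionGroup_offsetFamily_le (F : T3Family) (K n : ℕ)
    (W : GaugeField (F.P K) 0 (Matrix.specialUnitaryGroup (Fin 2) ℂ)) (ψ : Site (F.P K) 0 → Matrix (Fin 2) (Fin 2) ℂ)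
    (ι : Fin (F.P K).d) (ℓ' : ℕ) [NeZero ℓ']
    (S : Site (F.P K) (K - n) → Site (F.P K) 0 → (Matrix (Fin 2) (Fin 2) ℂ)ˣ)
    (hS : ∀ y z, ‖((S y z : (Matrix (Fin 2) (Fin 2) ℂ)ˣ) : Matrix (Fin 2) (Fin 2) ℂ)‖ ≤ 1 ∧ ‖(((S y z)⁻¹ : (Matrix (Fin 2) (Fin 2) ℂ)ˣ) : Matrix (Fin 2) (Fin 2) ℂ)‖ ≤ 1) :
    ∑ y : Site (F.P K) (K - n), ∑ z : Site (F.P K) 0,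
      (if (∀ ν : Fin (F.P K).d,
          (y ν = (iterBlockOf (K - n) (fun κ => z κ - (((((F.P K).L ^ (K - n) - 1) / 2 : ℕ)) : ZMod ((F.P K).sitesPerDir 0)))) ν - 1
          ∨ y ν = (iterBlockOf (K - n) (fun κ => z κ - (((((F.P K).L ^ (K - n) - 1) / 2 : ℕ)) : ZMod ((F.P K).sitesPerDir 0)))) ν
          ∨ y ν = (iterBlockOf (K - n) (fun κ => z κ - (((((F.P K).L ^ (K - n) - 1) / 2 : ℕ)) : ZMod ((F.P K).sitesPerDir 0)))) ν + 1
          ∨ y ν = (iterBlockOf (K - n) (fun κ => z κ - (((((F.P K).L ^ (K - n) - 1) / 2 : ℕ)) : ZMod ((F.P K).sitesPerDir 0)))) ν + 2))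
        then ∑ _μ : Fin (F.P K).d,
          ‖((ℓ' : ℝ)⁻¹ • ∑ η : Fin ℓ', R (axialT (unitsField (toUField W)) (transl (embIter (K - n) y) (((η : ℕ) : ℤ) • e ι)) z)⁻¹ (R (holT (unitsField (toUField W)) (embIter (K - n) y) (seg ι ((η : ℕ) : ℤ)))⁻¹ (ψ (embIter (K - n) y))))
            - ((ℓ' : ℝ)⁻¹ • ∑ η : Fin ℓ', R (axialT (unitsField (toUField W)) (transl (embIter (K - n) (iterBlockOf (K - n) (fun κ => z κ - (((((F.P K).L ^ (K - n) - 1) / 2 : ℕ)) : ZMod ((F.P K).sitesPerDir 0))))) (((η : ℕ) : ℤ) • e ι)) z)⁻¹ (R (holT (unitsField (toUField W)) (embIter (K - n) (iterBlockOf (K - n) (fun κ => z κ - (((((F.P K).L ^ (K - n) - 1) / 2 : ℕ)) : ZMod ((F.P K).sitesPerDir 0))))) (seg ι ((η : ℕ) : ℤ)))⁻¹ (ψ (embIter (K - n) (iterBlockOf (K - n) (fun κ => z κ - (((((F.P K).L ^ (K - n) - 1) / 2 : ℕ)) : ZMod ((F.P K).sitesPerDir 0))))))))‖ ^ 2 else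 0)
      ≤ ((F.P K).d : ℝ) * ∑ y : Site (F.P K) (K - n), ∑ z : Site (F.P K) 0,
      (if (∀ ν : Fin (F.P K).d,
          (y ν = (iterBlockOf (K - n) (fun κ => z κ - (((((F.P K).L ^ (K - n) - 1) / 2 : ℕ)) : ZMod ((F.P K).sitesPerDir 0)))) ν - 1
          ∨ y ν = (iterBlockOf (K - n) (fun κ => z κ - (((((F.P K).L ^ (K - n) - 1) / 2 : ℕ)) : ZMod ((F.P K).sitesPerDir 0)))) ν
          ∨ y ν = (iterBlockOf (K - n) (fun κ => z κ - (((((F.P K).L ^ (K - n) - 1) / 2 : ℕ)) : ZMod ((F.P K).sitesPerDir 0)))) ν + 1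
          ∨ y ν = (iterBlockOf (K - n) (fun κ => z κ - (((((F.P K).L ^ (K - n) - 1) / 2 : ℕ)) : ZMod ((F.P K).sitesPerDir 0)))) ν + 2))
        then (ℓ' : ℝ)⁻¹ * ∑ η : Fin ℓ', 2 * (‖R (S y z) (ψ (embIter (K - n) y)) - ψ (embIter (K - n) (iterBlockOf (K - n) (fun κ => z κ - (((((F.P K).L ^ (K - n) - 1) / 2 : ℕ)) : ZMod ((F.P K).sitesPerDir 0)))))‖ ^ 2
            + ‖(((S y z)⁻¹ * holT (unitsField (toUField W)) (embIter (K - n) (iterBlockOf (K - n) (fun κ => z κ - (((((F.P K).L ^ (K - n) - 1) / 2 : ℕ)) : ZMod ((F.P K).sitesPerDir 0))))) (seg ι ((η : ℕ) : ℤ) ++ treeWord (rel (transl (embIter (K - n) (iterBlockOf (K - n) (fun κ => z κ - (((((F.P K).L ^ (K - n) - 1) / 2 : ℕ)) : ZMod ((F.P K).sitesPerDir 0))))) (((η : ℕ) : ℤ) • e ι)) z)) * (holT (unitsField (toUField W)) (embIter (K - n) y) (seg ι ((η : ℕ) : ℤ) ++ treeWord (rel (transl (embIter (K - n) y) (((η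 : ℕ) : ℤ) • e ι)) z)))⁻¹ : (Matrix (Fin 2) (Fin 2) ℂ)ˣ) : Matrix (Fin 2) (Fin 2) ℂ) * ψ (embIter (K - n) y)
                - ψ (embIter (K - n) y) * (((S y z)⁻¹ * holT (unitsField (toUField W)) (embIter (K - n) (iterBlockOf (K - n) (fun κ => z κ - (((((F.P K).L ^ (K - n) - 1) / 2 : ℕ)) : ZMod ((F.P K).sitesPerDir 0))))) (seg ι ((η : ℕ) : ℤ) ++ treeWord (rel (transl (embIter (K - n) (iterBlockOf (K - n) (fun κ => z κ - (((((F.P K).L ^ (K - n) - 1) / 2 : ℕ)) : ZMod ((F.P K).sitesPerDir 0))))) (((η : ℕ) : ℤ) • e ι)) z)) * (holT (unitsField (toUField W)) (embIter (K - n) y) (seg ι ((η : ℕ) : ℤ) ++ treeWord (rel (transl (embIter (K - n) y) (((η : ℕ) : ℤ) • e ι)) z)))⁻¹ : (Matrix (Fin 2) (Fin 2) ℂ)ˣ) : Matrix (Fin 2) (Fin 2) ℂ)‖ ^ 2) else 0) := by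
  classical
  have hV : ∀ b : PBond (F.P K) 0, ‖((unitsField (toUField W) b : (Matrix (Fin 2) (Fin 2) ℂ)ˣ) : Matrix (Fin 2) (Fin 2) ℂ)‖ ≤ 1
      ∧ ‖(((unitsField (toUField W) b)⁻¹ : (Matrix (Fin 2) (Fin 2) ℂ)ˣ) : Matrix (Fin 2) (Fin 2) ℂ)‖ ≤ 1 :=
    fun b => bicontr_of_mem_unitary _ (unitsField_toUField_mem_unitary W b.dir b.src)
  have hcard : ((Fintype.card (Fin ℓ') : ℝ))⁻¹ = (ℓ' : ℝ)⁻¹ := by rw [Fintype.card_fin]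
  rw [Finset.mul_sum]
  refine Finset.sum_le_sum fun y _ => ?_
  rw [Finset.mul_sum]
  refine Finset.sum_le_sum fun z _ => ?_
  split_ifs with hz
  · rw [Finset.sum_const, Finset.card_univ, Fintype.card_fin, nsmul_eq_mul]
    refine mul_le_mul_of_nonneg_left ?_ (by positivity)
    have h1 := norm_sq_avg_axialModel_offset_sub_le (unitsField (toUField W)) hV (H := Fin ℓ') (fun η : Fin ℓ' => ((η : ℕ) : ℤ))
      (embIter (K - n) y) (embIter (K - n) (iterBlockOf (K - n) (fun κ => z κ - (((((F.P K).L ^ (K - n) - 1) / 2 : ℕ)) : ZMod ((F.P K).sitesPerDir 0))))) ι z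
      (ψ (embIter (K - n) y)) (ψ (embIter (K - n) (iterBlockOf (K - n) (fun κ => z κ - (((((F.P K).L ^ (K - n) - 1) / 2 : ℕ)) : ZMod ((F.P K).sitesPerDir 0)))))) (S y z) (hS y z)
    rw [hcard] at h1
    exact h1
  · simp

end T3

end Summit.QuantumFields.YangMills.Theorems.Prop7JunctionGroupOfOffsetFamily

end
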